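import Summits.AtomisticToContinuum.FouriersLaw.Theorems.ParityLiouvilleSeedLiouvilleForHeatHarmonicDefs

/-!
# The radiating Gaussian state of the harmonic chain: the Gaussian coupling of a box (definitions)

Definitions for the REGULARITY part of the harmonic tightness witness of
`ParityLiouvilleSeed.LiouvilleForHeat` (`stmt-AtomisticToContinuum-13980`) /
`ZeroCurrentRigidity` (`stmt-AtomisticToContinuum-12073`); objects of
`ParityLiouvilleSeedLiouvilleForHeatHarmonicDefs` (`Idx`, `Src`, `gaussField`, `noiseVar`).

The box marginal on `Λ = {a, …, a+n}` of the radiating state is the image of finitely many noise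
coordinates: `q_x = ξ_x` (`x ∈ Λ`), `p_x = η_x + ℓ_x(ξ, ζ')` with the MOMENTUM OFFSET
`ℓ_x = (ξ_{x+1} - ξ_{x-1})/2 + (ζ'_x - 2ζ'_{x-1} + ζ'_{x-2})/2` reading `ξ` on `{a-1, …, a+n+1}` and
`ζ'` on `{a-2, …, a+n}`. We collect these coordinates in the COUPLING SPACE
`Cpl n = ((Fin (n+1) → ℝ) × (Fin (n+5) → ℝ)) × (Fin (n+1) → ℝ)` — `((ξ_Λ, extras), η_Λ)`, the
extras being `ξ_{a-1}, ξ_{a+n+1}, ζ'_{a-2}, …, ζ'_{a+n}` — so that the field map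
`cplField : Cpl n → (Fin (n+1) → ℝ × ℝ)` is a SHEAR `((q, u), e) ↦ (q, e + ℓ(q, u))` followed by
forgetting `u`: this is what makes Lebesgue integrals on the box phase space computable as Gaussian
expectations (the entropy bound behind regularity).

* `extraIdx a n : Fin (n+5) → Idx` — the extra coordinates; `cplRestrict a n : Src → Cpl n`;
* `cplXi`, `cplZe` — the values `ξ_x`, `ζ'_x` read off a point of `(Fin (n+1) → ℝ) × (Fin (n+5) → ℝ)`
  (zero outside their ranges); `cplShift a n` — the offset `ℓ`; `cplField a n` — the field map;
* `cplMeasure ω₂ n` — the product Gaussian law `(⊗N(0,1) ⊗ ⊗N(0,1)) ⊗ ⊗N(0,ω₂)` on `Cpl n`.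
-/

noncomputable section

open MeasureTheory ProbabilityTheory
open scoped NNReal
open Literature.MathematicalPhysics.KineticTheory.HeatConduction

namespace Summit.AtomisticToContinuum.FouriersLaw.Theorems.ParityLiouvilleSeed.HarmonicWitness

/-- The coupling space of the box `{a, …, a+n}`: `((ξ_Λ, extras), η_Λ)`. [folklore] -/
abbrev Cpl (n : ℕ) : Type := ((Fin (n + 1) → ℝ) × (Fin (n + 5) → ℝ)) × (Fin (n + 1) → ℝ)

/-- The extra noise coordinates feeding the box momenta: `j = 0 ↦ ξ_{a-1}`, `j = 1 ↦ ξ_{a+n+1}`,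
`j = m + 2 ↦ ζ'_{a-2+m}` (`m = 0, …, n+2`). [folklore] -/
def extraIdx (a : ℤ) (n : ℕ) (j : Fin (n + 5)) : Idx :=
  if j.val = 0 then (a - 1, 0) else if j.val = 1 then (a + n + 1, 0) else (a - 4 + j.val, 2)

/-- The coupling coordinates of a noise configuration. [folklore] -/
def cplRestrict (a : ℤ) (n : ℕ) (ζ : Src) : Cpl n :=
  ((fun i => ζ (a + i, 0), fun j => ζ (extraIdx a n j)), fun i => ζ (a + i, 1))

/-- `ξ_x` read off the coupling coordinates (`x ∈ {a-1, …, a+n+1}`, zero otherwise). [folklore] -/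
def cplXi (a : ℤ) (n : ℕ) (w : (Fin (n + 1) → ℝ) × (Fin (n + 5) → ℝ)) (x : ℤ) : ℝ :=
  if h : a ≤ x ∧ x ≤ a + n then w.1 ⟨(x - a).toNat, by omega⟩
  else if x = a - 1 then w.2 ⟨0, by omega⟩ else if x = a + n + 1 then w.2 ⟨1, by omega⟩ else 0

/-- `ζ'_x` read off the coupling coordinates (`x ∈ {a-2, …, a+n}`, zero otherwise). [folklore] -/
def cplZe (a : ℤ) (n : ℕ) (w : (Fin (n + 1) → ℝ) × (Fin (n + 5) → ℝ)) (x : ℤ) : ℝ :=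
  if h : a - 2 ≤ x ∧ x ≤ a + n then w.2 ⟨(x - a + 4).toNat, by omega⟩ else 0

/-- **The momentum offset** `ℓ_i = (ξ_{x+1} - ξ_{x-1})/2 + (ζ'_x - 2ζ'_{x-1} + ζ'_{x-2})/2`,
`x = a + i`. [folklore] -/
def cplShift (a : ℤ) (n : ℕ) (w : (Fin (n + 1) → ℝ) × (Fin (n + 5) → ℝ)) : Fin (n + 1) → ℝ := fun i =>
  (cplXi a n w (a + i + 1) - cplXi a n w (a + i - 1)) / 2 +
    (cplZe a n w (a + i) - 2 * cplZe a n w (a + i - 1) + cplZe a n w (a + i - 2)) / 2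

/-- **The coupling field map** `((q, u), e) ↦ (q_i, e_i + ℓ_i(q, u))_i`: box phase coordinates as a
shear of the coupling coordinates. [folklore] -/
def cplField (a : ℤ) (n : ℕ) (w : Cpl n) : Fin (n + 1) → ℝ × ℝ := fun i =>
  (w.1.1 i, w.2 i + cplShift a n w.1 i)

/-- **The coupling law**: independent centred Gaussians, variance `1` on `ξ_Λ` and the extras,
`noiseVar ω₂ 1` (`= ω₂`) on `η_Λ`. [folklore] -/
def cplMeasure (ω₂ : ℝ) (n : ℕ) : Measure (Cpl n) :=
  ((Measure.pi fun _ : Fin (n + 1) => gaussianReal 0 1).prod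
      (Measure.pi fun _ : Fin (n + 5) => gaussianReal 0 1)).prod
    (Measure.pi fun _ : Fin (n + 1) => gaussianReal 0 (noiseVar ω₂ 1))

/-! ### Immediate API -/

/-- [folklore] -/
instance (ω₂ : ℝ) (n : ℕ) : IsProbabilityMeasure (cplMeasure ω₂ n) := by
  unfold cplMeasure; infer_instance

/-- [folklore] -/
@[simp] theorem cplField_apply_fst (a : ℤ) (n : ℕ) (w : Cpl n) (i : Fin (n + 1)) :
    (cplField a n w i).1 = w.1.1 i := rfl

/-- [folklore] -/
@[simp] theorem cplField_apply_snd (a : ℤ) (n : ℕ) (w : Cpl n) (i : Fin (n + 1)) :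
    (cplField a n w i).2 = w.2 i + cplShift a n w.1 i := rfl

/-- [folklore] -/
@[simp] theorem cplRestrict_fst_fst (a : ℤ) (n : ℕ) (ζ : Src) (i : Fin (n + 1)) :
    (cplRestrict a n ζ).1.1 i = ζ (a + i, 0) := rfl

/-- [folklore] -/
@[simp] theorem cplRestrict_fst_snd (a : ℤ) (n : ℕ) (ζ : Src) (j : Fin (n + 5)) :
    (cplRestrict a n ζ).1.2 j = ζ (extraIdx a n j) := rfl

/-- [folklore] -/
@[simp] theorem cplRestrict_snd (a : ℤ) (n : ℕ) (ζ : Src) (i : Fin (n + 1)) :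
    (cplRestrict a n ζ).2 i = ζ (a + i, 1) := rfl

/-- The coupling coordinates depend measurably on the noise. [folklore] -/
@[fun_prop]
theorem measurable_cplRestrict (a : ℤ) (n : ℕ) : Measurable (cplRestrict a n) := by
  refine Measurable.prodMk (Measurable.prodMk ?_ ?_) ?_
  · exact measurable_pi_lambda _ fun i => measurable_pi_apply _
  · exact measurable_pi_lambda _ fun j => measurable_pi_apply _
  · exact measurable_pi_lambda _ fun i => measurable_pi_apply _

/-- `ξ_x` is a continuous function of the coupling coordinates. [folklore] -/
@[fun_prop]
theorem continuous_cplXi (a : ℤ) (n : ℕ) (x : ℤ) :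
    Continuous fun w : (Fin (n + 1) → ℝ) × (Fin (n + 5) → ℝ) => cplXi a n w x := by
  unfold cplXi
  split_ifs <;> fun_prop

/-- `ζ'_x` is a continuous function of the coupling coordinates. [folklore] -/
@[fun_prop]
theorem continuous_cplZe (a : ℤ) (n : ℕ) (x : ℤ) :
    Continuous fun w : (Fin (n + 1) → ℝ) × (Fin (n + 5) → ℝ) => cplZe a n w x := by
  unfold cplZe
  split_ifs <;> fun_prop

/-- The offset is continuous. [folklore] -/
@[fun_prop]
theorem continuous_cplShift (a : ℤ) (n : ℕ) :
    Continuous fun w : (Fin (n + 1) → ℝ) × (Fin (n + 5) → ℝ) => cplShift a n w := by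
  refine continuous_pi fun i => ?_
  unfold cplShift
  fun_prop

/-- The coupling field map is continuous. [folklore] -/
@[fun_prop]
theorem continuous_cplField (a : ℤ) (n : ℕ) : Continuous (cplField a n) := by
  refine continuous_pi fun i => Continuous.prodMk (by fun_prop) ?_
  exact ((continuous_apply i).comp continuous_snd).add
    ((continuous_apply i).comp ((continuous_cplShift a n).comp continuous_fst))

/-- The coupling field map is measurable. [folklore] -/
@[fun_prop]
theorem measurable_cplField (a : ℤ) (n : ℕ) : Measurable (cplField a n) :=
  (continuous_cplField a n).measurable

end Summit.AtomisticToContinuum.FouriersLaw.Theorems.ParityLiouvilleSeed.HarmonicWitness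

end
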